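import Summits.ResolutionOfSingularities.ResolutionOfSingularities.Theorems.PurelyInseparableDim4ResConeReduction
import Summits.ResolutionOfSingularities.ResolutionOfSingularities.Theorems.PurelyInseparableDim4ResConeShadeZero
import HarnessLib
import HarnessLib.Audit.Tags

/-!
# Purely inseparable four-folds — THE LOCATED RESIDUE OF K2(p) AFTER THE TAME-CONE FRAME:
# constant `(d, e_G)` traps with `1 ≤ d ≤ 2p − 2` and `2 ≤ e_G ≤ 4` (every prime)

[OURS · counted 0 · cell `res-dim4-pi` · seat res-dim4-p-12 g2 · K2(p) lane (desk WORD #66 (2)).]  Nothing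
here proves K2(p), `NoIsolatedTrap p p` or resolution of singularities in dimension ≥ 4 / characteristic `p`.

Bookkeeping only: FILE 3d (`noAboveFloorTrap_iff_noConstantVertexTrap`: constant shade `d`, constant polar-
kernel rank `e ≥ 2`) + FILE 3e (`noConstantShadeZeroTrap`: `d ≠ 0`) + `finrank ≤ 4` + the band
(`ord₀ ≤ 2p − 2`) give **`noAboveFloorTrap_iff_noLocatedTrap`**: K2(p) = `RidgeBudget.NoAboveFloorTrap p p`
holds iff no field of characteristic `p` carries an isolated above-floor `Step0 p` chain with `x^{r₀} ∣ F₀`,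
constant NATURAL shade `d ∈ [1, 2p − 2]` and constant `e_G = e ∈ [2, 4]`.  These numbers locate what is
open; they prove nothing about it.
bears_on: LADDER-RESOLUTION:D157-DOOR2 (res-dim4-pi · K2(p)).  Supports stmt-ResolutionOfSingularities-16155
(helper).
-/

set_option linter.dupNamespace false -- mandated namespace of this single-conjunct summit

noncomputable section

namespace Summit.ResolutionOfSingularities.ResolutionOfSingularities.Theorems.PIDim4

namespace ResCone

open MvPolynomial Finset
open Literature.AlgebraicGeometry.Resolution
open Literature.AlgebraicGeometry.Resolution.CentreBlowup
open Literature.AlgebraicGeometry.Resolution.Hauser2010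
open Literature.AlgebraicGeometry.Resolution.HauserPerlega2019
open PointBlowup (polarMap additiveSubspace direction)

variable {K : Type} [Field K]

/-- The polar kernel lives in `K⁴`: `e_G ≤ 4`. [folklore] -/
theorem finrank_resVertex_le_four (s : State K) : Module.finrank K (resVertex s) ≤ 4 := by
  have h := Submodule.finrank_le (resVertex s)
  rwa [Module.finrank_fin_fun] at h

/-- **K2(p) ⟺ NO LOCATED TRAP** (every prime `p`): `RidgeBudget.NoAboveFloorTrap p p` iff over every field
of characteristic `p` there is no isolated above-floor `Step0 p` chain with `x^{r₀} ∣ F₀`, constant natural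
shade `d` with `1 ≤ d ≤ 2p − 2` and constant polar-kernel rank `e` with `2 ≤ e ≤ 4`.
[OURS] [cite: CossartJannsenSaito2020, Thm. 3.14] -/
theorem noAboveFloorTrap_iff_noLocatedTrap (p : ℕ) [Fact p.Prime] :
    RidgeBudget.NoAboveFloorTrap p p ↔ ∀ (K : Type) [Field K] [CharP K p] [DecidableEq K],
      ¬ ∃ (c : ℕ → State K) (d e : ℕ), 1 ≤ d ∧ d ≤ 2 * p - 2 ∧ 2 ≤ e ∧ e ≤ 4 ∧
        (∀ e' ∈ (c 0).F.support, (c 0).r ≤ e') ∧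
        ∀ k, IsIsolated p (c k).F ∧ Step0 p (c k) (c (k + 1)) ∧ ordZero (c k).F ≠ p ∧
          (c k).shade = (d : ℕ∞) ∧ Module.finrank K (resVertex (c k)) = e := by
  rw [noAboveFloorTrap_iff_noConstantVertexTrap]
  constructor
  · intro h K _ _ _
    rintro ⟨c, d, e, -, -, he, -, hr0, hc⟩
    exact h K ⟨c, (d : ℕ∞), e, he, hr0, hc⟩
  · intro h K _ _ _
    rintro ⟨c, d, e, he, hr0, hc⟩
    have hc2 : ∀ k, IsIsolated p (c k).F ∧ Step0 p (c k) (c (k + 1)) := fun k => ⟨(hc k).1, (hc k).2.1⟩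
    -- the shade is a natural number `o₀ − |r₀|`
    obtain ⟨o, ho, _, ho2⟩ := BandShade.exists_ordZero_eq p hc2 0
    have hd : d = ((o - (c 0).r.degree : ℕ) : ℕ∞) := by
      rw [← (hc 0).2.2.2.1, BandShade.shade_eq_coe ho]
    have hd0 : d ≠ 0 :=
      shade_ne_zero_of_constantShadeTrap p hr0 fun k => ⟨(hc k).1, (hc k).2.1, (hc k).2.2.2.1⟩
    refine h K ⟨c, o - (c 0).r.degree, e, ?_, by omega, he, ?_, hr0, fun k =>
      ⟨(hc k).1, (hc k).2.1, (hc k).2.2.1, by rw [(hc k).2.2.2.1, hd], (hc k).2.2.2.2⟩⟩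
    · by_contra hlt
      apply hd0
      rw [hd]
      have : o - (c 0).r.degree = 0 := by omega
      rw [this]
      rfl
    · rw [← (hc 0).2.2.2.2]
      exact finrank_resVertex_le_four (c 0)

end ResCone

end Summit.ResolutionOfSingularities.ResolutionOfSingularities.Theorems.PIDim4

end
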